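import Mathlib
import HarnessLib
import Summits.CriticalPhenomena.CardyFormulaZ2.Theses.CardySelfRefinement
import Literature.Probability.RandomPlanarGeometry.ChordalReversibility
import Literature.Probability.RandomPlanarGeometry.ConformalRectangle
import Literature.Probability.RandomPlanarGeometry.IsometryCovariance
import Summits.CriticalPhenomena.CardyFormulaZ2.Theorems.CardySelfRefinementSymmetryUpgradeRTouchSepCore
import Summits.CriticalPhenomena.CardyFormulaZ2.Theorems.CardySelfRefinementSymmetryUpgradeRTouchSepTriangle

/-!
# The discrete dictionary for the triangle domain: the exploration separates the wired cluster
from the free arc (L1 `touchExponent_sepDictionary` of stub `stub_touchExponent`, line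
`SketchIdeatorTwo`, crux `SymmetryUpgradeR`, stmt-CriticalPhenomena-17239)

`touchExponent_sepDictionary` (registered; hypothesis `hL1` of `touchExponent_plan`): for every
Dobrushin domain with carrier `Δ = {re < 0, im < 0, re + im > -1}`, every `ℤ²`-discretisation
family `E` of it and every admissible mesh, a `bcBondConfig ω`-open path from a site of the
discrete WIRED arc `A` to a site `v` forces the medial exploration polyline within
`dist(δv, δw) + 4δ` of `δv`, for every site `w` of the discrete FREE arc `B`.

Assembly of: the winding-number core `touchExponent_sepDictionary_core` (…`TouchSepCore`), the
boundary-cycle labels (…`TouchSepCycle`) and the lattice geometry of the triangle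
(…`TouchSepTriangle`), plus (here) `sepDict_tri_W_eq_one`: EVERY inner face of the staircase
triangle has winding number one for the boundary cycle (chains of inner faces east and north to
the corner face), so that every face-boundary dart — in particular at every boundary site on an
inner face — lies on the boundary cycle from `e_a`; the two filament tips hang on same-label
sites.  Metric bookkeeping: the visited edge found on the monotone box walk from `v` to `w` has
its midpoint, a vertex of the polyline, within `dist(δv, δw)` of `δv` (`+ δ` through a tip).

References: S. Smirnov, C. R. Acad. Sci. Paris 333 (2001), §2; G. Grimmett, *Percolation* (1999),
§11.2.
-/

noncomputable section

namespace Summit.CriticalPhenomena.CardyFormulaZ2.Theorems.SymmetryUpgradeR.SwallowingSkeleton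

open MeasureTheory Filter Set
open Literature.Probability.RandomPlanarGeometry Literature.Probability.LatticeModels
  Literature.Probability.Percolation
open UpperHalfPlane (upperHalfPlaneSet)
open SimpleGraph DiscreteDobrushin

/-! ### Every inner face of the discrete triangle has winding number one -/

/-- A straight chain of inner faces towards the east keeps the winding number of the boundary
cycle. -/
theorem sepDict_W_chain_east {E : DiscreteDobrushin} (hE : E.IsZdAdmissible) (F : Site 2) :
    ∀ n : ℕ, (∀ m : ℕ, m ≤ n → E.IsInnerFace (F + (m : ℤ) • cornerUnit 0)) →
      (bcycle hE).W (toZ2 F) = (bcycle hE).W (toZ2 (F + (n : ℤ) • cornerUnit 0))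
  | 0, _ => by simp
  | n + 1, h => by
    rw [sepDict_W_chain_east hE F n fun m hm => h m (Nat.le_succ_of_le hm)]
    -- the faces `F + n e₀` and `F + (n+1) e₀` are the faces `1` and `0` around `F + (n+1) e₀`
    have e1 : faceAt (F + ((n + 1 : ℕ) : ℤ) • cornerUnit 0) 1 = F + (n : ℤ) • cornerUnit 0 := by
      simp only [faceAt, cornerOff, cornerUnit]; push_cast; rw [add_smul, one_smul]; abel
    have e0 : faceAt (F + ((n + 1 : ℕ) : ℤ) • cornerUnit 0) (1 + 3) = F + ((n + 1 : ℕ) : ℤ) • cornerUnit 0 := by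
      simp [faceAt, cornerOff]
    have key := sepDict_W_eq_of_inner hE (x := F + ((n + 1 : ℕ) : ℤ) • cornerUnit 0) (k := 1)
      (by rw [e1]; exact h n (Nat.le_succ n)) (by rw [e0]; exact h (n + 1) le_rfl)
    rw [e1, e0] at key
    exact key

/-- A straight chain of inner faces towards the north keeps the winding number of the boundary
cycle. -/
theorem sepDict_W_chain_north {E : DiscreteDobrushin} (hE : E.IsZdAdmissible) (F : Site 2) :
    ∀ n : ℕ, (∀ m : ℕ, m ≤ n → E.IsInnerFace (F + (m : ℤ) • cornerUnit 1)) →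
      (bcycle hE).W (toZ2 F) = (bcycle hE).W (toZ2 (F + (n : ℤ) • cornerUnit 1))
  | 0, _ => by simp
  | n + 1, h => by
    rw [sepDict_W_chain_north hE F n fun m hm => h m (Nat.le_succ_of_le hm)]
    have e3 : faceAt (F + ((n + 1 : ℕ) : ℤ) • cornerUnit 1) (0 + 3) = F + (n : ℤ) • cornerUnit 1 := by
      rw [show (0 : Fin 4) + 3 = 3 from rfl]
      simp only [faceAt, cornerOff, cornerUnit]; push_cast; rw [add_smul, one_smul]; abel
    have e0 : faceAt (F + ((n + 1 : ℕ) : ℤ) • cornerUnit 1) 0 = F + ((n + 1 : ℕ) : ℤ) • cornerUnit 1 := by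
      simp [faceAt, cornerOff]
    have key := sepDict_W_eq_of_inner hE (x := F + ((n + 1 : ℕ) : ℤ) • cornerUnit 1) (k := 0)
      (by rw [e0]; exact h (n + 1) le_rfl) (by rw [e3]; exact h n (Nat.le_succ n))
    rw [e3, e0] at key
    exact key.symm


/-- **Every inner face of the discrete triangle has winding number one** for the boundary cycle
from `e_a`: the inner faces form a staircase polyomino, chained (east, then north) to the corner
face `(-2, -2) + [0,1]²`, and so is the (inner) face of the start corner, whose winding number is
one. -/
theorem sepDict_tri_W_eq_one {E : DiscreteDobrushin} (J : JordanDomain) (hΩJ : E.Ω = J.carrier)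
    (hΩ : E.Ω = {w : ℂ | w.re < 0 ∧ w.im < 0 ∧ -1 < w.re + w.im}) (hE : E.IsZdAdmissible)
    {F : Site 2} (hF : E.IsInnerFace F) : (bcycle hE).W (toZ2 F) = 1 := by
  have hδ := hE.delta_pos
  have hreg := regular_of_eq_carrier (D := E) J hΩJ
  -- every inner face chains to the corner face `(-2, -2)`
  have red : ∀ F : Site 2, E.IsInnerFace F →
      ∃ c : Site 2, c 0 = -2 ∧ c 1 = -2 ∧ (bcycle hE).W (toZ2 F) = (bcycle hE).W (toZ2 c) := by
    intro F hF
    obtain ⟨h0, h1, hs⟩ := (sepDict_tri_isInnerFace_iff hΩ hδ F).1 hF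
    -- east to the column `-2`
    have heast := sepDict_W_chain_east hE F (-2 - F 0).toNat fun m hm => by
      rw [sepDict_tri_isInnerFace_iff hΩ hδ]
      obtain ⟨e0, e1⟩ := FineBlocks.apply_add_smul_cornerUnit_zero F (m : ℤ)
      rw [e0, e1]
      have hm' : (m : ℤ) ≤ (-2 - F 0).toNat := by exact_mod_cast hm
      rw [Int.toNat_of_nonneg (by omega)] at hm'
      refine ⟨by omega, h1, ?_⟩
      have : ((F 0 : ℤ) : ℝ) + ((F 1 : ℤ) : ℝ) ≤ ((F 0 + m : ℤ) : ℝ) + ((F 1 : ℤ) : ℝ) := by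
        exact_mod_cast (show F 0 + F 1 ≤ F 0 + m + F 1 by omega)
      nlinarith
    have hF'0 : (F + ((-2 - F 0).toNat : ℤ) • cornerUnit 0) 0 = -2 := by
      rw [(FineBlocks.apply_add_smul_cornerUnit_zero F _).1, Int.toNat_of_nonneg (by omega)]; ring
    have hF'1 : (F + ((-2 - F 0).toNat : ℤ) • cornerUnit 0) 1 = F 1 :=
      (FineBlocks.apply_add_smul_cornerUnit_zero F _).2
    -- north to the row `-2`
    have hnorth := sepDict_W_chain_north hE (F + ((-2 - F 0).toNat : ℤ) • cornerUnit 0)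
      (-2 - F 1).toNat fun m hm => by
      rw [sepDict_tri_isInnerFace_iff hΩ hδ]
      obtain ⟨e0, e1⟩ := FineBlocks.apply_add_smul_cornerUnit_one (F + ((-2 - F 0).toNat : ℤ) • cornerUnit 0) (m : ℤ)
      rw [e0, e1, hF'0, hF'1]
      have hm' : (m : ℤ) ≤ (-2 - F 1).toNat := by exact_mod_cast hm
      rw [Int.toNat_of_nonneg (by omega)] at hm'
      refine ⟨by norm_num, by omega, ?_⟩
      have : ((F 0 : ℤ) : ℝ) + ((F 1 : ℤ) : ℝ) ≤ ((-2 : ℤ) : ℝ) + ((F 1 + m : ℤ) : ℝ) := by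
        exact_mod_cast (show F 0 + F 1 ≤ -2 + (F 1 + m) by omega)
      nlinarith
    refine ⟨_, ?_, ?_, heast.trans hnorth⟩
    · rw [(FineBlocks.apply_add_smul_cornerUnit_one _ _).1, hF'0]
    · rw [(FineBlocks.apply_add_smul_cornerUnit_one _ _).2, hF'1, Int.toNat_of_nonneg (by omega)]; ring
  obtain ⟨c, hc0, hc1, hW⟩ := red F hF
  obtain ⟨c', hc'0, hc'1, hW'⟩ := red _ (isStartCorner_startCorner hE).isOutEdge.1
  have hcc' : c = c' := Site.eq_iff_two.2 ⟨by rw [hc0, hc'0], by rw [hc1, hc'1]⟩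
  have h1 := W_bcycle_cFace_cornerOrbit hE hreg.1 hreg.2.1 hreg.2.2.1 hreg.2.2.2 ∅ (exitTime_pos hE ∅)
  rw [cornerOrbit_zero] at h1
  rw [hW, hcc', ← hW']
  exact h1


/-! ### Metric bookkeeping -/

/-- A site of the bounding box of `v` and `w` is, at mesh `δ`, no farther from `v` than `w` is. -/
theorem sepDict_dist_le_of_box (δ : ℝ) {z v w : Site 2}
    (h0 : min (v 0) (w 0) ≤ z 0 ∧ z 0 ≤ max (v 0) (w 0))
    (h1 : min (v 1) (w 1) ≤ z 1 ∧ z 1 ≤ max (v 1) (w 1)) :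
    dist (meshPoint δ z) (meshPoint δ v) ≤ dist (meshPoint δ v) (meshPoint δ w) := by
  have hsq0 : (z 0 - v 0) ^ 2 ≤ (w 0 - v 0) ^ 2 := by
    rcases le_total (v 0) (w 0) with h | h
    · rw [min_eq_left h, max_eq_right h] at h0; nlinarith
    · rw [min_eq_right h, max_eq_left h] at h0; nlinarith
  have hsq1 : (z 1 - v 1) ^ 2 ≤ (w 1 - v 1) ^ 2 := by
    rcases le_total (v 1) (w 1) with h | h
    · rw [min_eq_left h, max_eq_right h] at h1; nlinarith
    · rw [min_eq_right h, max_eq_left h] at h1; nlinarith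
  have hr0 : (((z 0 : ℤ) : ℝ) - v 0) ^ 2 ≤ (((w 0 : ℤ) : ℝ) - v 0) ^ 2 := by exact_mod_cast hsq0
  have hr1 : (((z 1 : ℤ) : ℝ) - v 1) ^ 2 ≤ (((w 1 : ℤ) : ℝ) - v 1) ^ 2 := by exact_mod_cast hsq1
  rw [Complex.dist_eq, Complex.dist_eq]
  refine (pow_le_pow_iff_left₀ (norm_nonneg _) (norm_nonneg _) two_ne_zero).1 ?_
  rw [Complex.sq_norm, Complex.sq_norm, Complex.normSq_apply, Complex.normSq_apply]
  simp only [Complex.sub_re, Complex.sub_im, meshPoint_re, meshPoint_im]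
  have hδ2 : 0 ≤ δ ^ 2 := sq_nonneg δ
  nlinarith [mul_le_mul_of_nonneg_left hr0 hδ2, mul_le_mul_of_nonneg_left hr1 hδ2]

/-- The midpoint of an edge is no farther from `V` than the farther of its endpoints. -/
theorem sepDict_dist_medialPoint_le (δ : ℝ) (p q : Site 2) (V : ℂ) {r : ℝ}
    (hp : dist (meshPoint δ p) V ≤ r) (hq : dist (meshPoint δ q) V ≤ r) :
    dist (medialPoint δ s(p, q)) V ≤ r := by
  rw [medialPoint_mk, Complex.dist_eq]
  rw [Complex.dist_eq] at hp hq
  have : (meshPoint δ p + meshPoint δ q) / 2 - V = ((meshPoint δ p - V) + (meshPoint δ q - V)) / 2 := by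
    ring
  rw [this, norm_div, Complex.norm_two]
  linarith [norm_add_le (meshPoint δ p - V) (meshPoint δ q - V)]

/-- Lattice neighbours are `δ` apart at mesh `δ`. -/
theorem sepDict_dist_add_cornerUnit {δ : ℝ} (hδ : 0 < δ) (v : Site 2) (k : Fin 4) :
    dist (meshPoint δ v) (meshPoint δ (v + cornerUnit k)) = δ := by
  rw [_root_.dist_comm, Complex.dist_eq, Complex.norm_eq_sqrt_sq_add_sq]
  simp only [Complex.sub_re, Complex.sub_im, meshPoint_re, meshPoint_im, Pi.add_apply, Int.cast_add]
  fin_cases k <;> simp [cornerUnit] <;> (ring_nf; exact Real.sqrt_sq hδ.le)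

/-! ### The registered statement -/

/-- **L1 `touchExponent_sepDictionary` (the discrete dictionary / separation statement for the
triangle domain).** For admissible data of a `ℤ²`-discretisation family of the triangle
`Δ = {re < 0, im < 0, re + im > -1}`, a path of the completed configuration `bcBondConfig ω` from
a site of the discrete wired arc `A` to a site `v` forces the exploration polyline to pass within
`dist(δv, δw) + 4δ` of `δv`, for every site `w` of the discrete free arc `B`: the exploration
separates the wired cluster from the free arc. Proof: the wired cluster of any `A`-site is the
wired cluster of the `A`-end of `e_a` (the `A`-stretch of the boundary cycle is wired; the two
filament tips of the discrete triangle hang on same-label sites); a `B`-site on an inner face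
sits on the `B`-stretch of the boundary cycle (all inner faces of the staircase triangle have
winding number one, so every face-boundary dart is on the cycle); the monotone box walk from `v`
to `w` inside the convex triangle then meets a visited edge (`touchExponent_sepDictionary_core`),
whose midpoint is a vertex of the polyline within `dist(δv, δw)` of `δv`; a `B`-tip is one
lattice step from a `B`-site on an inner face. -/
theorem touchExponent_sepDictionary : ∀ (D : DobrushinDomain) (E : ℝ → DiscreteDobrushin), D.carrier = {w : ℂ | w.re < 0 ∧ w.im < 0 ∧ -1 < w.re + w.im} → D.pt 0 = -1 → D.pt 1 = -Complex.I → D.arc 0 = segment ℝ (-1 : ℂ) 0 ∪ segment ℝ (0 : ℂ) (-Complex.I) → D.arc 1 = segment ℝ (-Complex.I) (-1 : ℂ) → ZdDiscretisationFamily D E → ∀ δ : ℝ, (E δ).IsZdAdmissible → ∀ (ω : BondConfig (Site 2)) (u v w : Site 2), u ∈ (E δ).zdArcA → w ∈ (E δ).zdArcB → (E δ).bcBondConfig ω ∈ openConnIn Set.univ u v → ∃ t : unitInterval, dist (medialExplorationCurve (E δ) ω t) (meshPoint (E δ).δ v) ≤ dist (meshPoint (E δ).δ v) (meshPoint (E δ).δ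 w) + 4 * (E δ).δ := by
  intro D E hcar _ _ _ _ hfam δ hadm ω u v w hu hw hconn
  classical
  have hΩJ : (E δ).Ω = D.toJordanDomain.carrier := hfam.Ω_eq δ
  have hΩ : (E δ).Ω = {w : ℂ | w.re < 0 ∧ w.im < 0 ∧ -1 < w.re + w.im} := by rw [hfam.Ω_eq δ, hcar]
  have hδ : 0 < (E δ).δ := hadm.delta_pos
  have hreg := regular_of_eq_carrier (D := E δ) D.toJordanDomain hΩJ
  obtain ⟨tb, htbP, htbeq⟩ := exists_bwalk_eq_ebDart hadm hreg.1 hreg.2.1 hreg.2.2.1 hreg.2.2.2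
  have h4 : 4 * (E δ).δ < 1 :=
    sepDict_four_mul_delta_lt hΩ hδ (isStartCorner_startCorner hadm).isOutEdge.1
  have hGzd : discreteDomainGraph (E δ).Ω (E δ).δ ≤ zdGraph 2 :=
    (discreteDomainGraph_le_meshGraph _ _).trans (meshGraph_le_zdGraph _ _)
  -- sites of `Ω_δ` are sites of the triangle
  have hmesh : ∀ x ∈ meshDomain (E δ).Ω (E δ).δ,
      x ∈ meshVertices {w : ℂ | w.re < 0 ∧ w.im < 0 ∧ -1 < w.re + w.im} (E δ).δ := by
    intro x hx; rw [← hΩ]; exact meshDomain_subset_meshVertices _ _ hx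
  -- (1) boundary sites on an inner face are vertices of the boundary cycle
  have oncycle : ∀ x F : Site 2, x ∈ (E δ).zdBoundary → IsCorner x F → (E δ).IsInnerFace F →
      ∃ s < bperiod hadm (isOutEdge_startCorner hadm), x = ((E δ).bwalk (startCorner hadm) s).1 := by
    intro x F hx hxF hF
    obtain ⟨k, hk⟩ := sepDict_exists_isOutEdge_of_zdBoundary hx hxF hF
    obtain ⟨s, hs, hseq⟩ := sepDict_exists_bwalk_eq D.toJordanDomain hΩJ hadm hk
      (sepDict_tri_W_eq_one D.toJordanDomain hΩJ hΩ hadm hk.1)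
    exact ⟨s, hs, by rw [hseq]⟩
  -- (2) a boundary site on no inner face hangs on a same-label boundary site on an inner face
  have tip : ∀ x : Site 2, x ∈ (E δ).zdBoundary → (∀ F, IsCorner x F → ¬ (E δ).IsInnerFace F) →
      ∃ y : Site 2, (∃ F, IsCorner y F ∧ (E δ).IsInnerFace F) ∧ y ∈ (E δ).zdBoundary ∧
        (discreteDomainGraph (E δ).Ω (E δ).δ).Adj x y ∧
        ((x ∈ (E δ).zdArcA ∧ y ∈ (E δ).zdArcA) ∨ (x ∈ (E δ).zdArcB ∧ y ∈ (E δ).zdArcB)) ∧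
        dist (meshPoint (E δ).δ x) (meshPoint (E δ).δ y) = (E δ).δ := by
    intro x hx hno
    have hxm := hmesh x (zdBoundary_subset_meshDomain _ hx)
    obtain ⟨k, j, hym, hyin⟩ := sepDict_tri_tip hΩ hδ h4 hxm fun k => hno _ (isCorner_faceAt x k)
    have hadj : (discreteDomainGraph (E δ).Ω (E δ).δ).Adj x (x + cornerUnit k) := by
      rw [hΩ, sepDict_tri_adj_iff hδ, ← hΩ]
      exact ⟨(SimpleGraph.mem_edgeSet _).1 (cSrc_mem_edgeSet (x, k)), by rwa [hΩ], by rwa [hΩ]⟩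
    obtain ⟨k', hk'⟩ := sepDict_exists_isOutEdge_of_corner (isCorner_faceAt _ j) hyin
      ((isCorner_add_faceAt_iff x k k).2 (Or.inl rfl)) (hno _ (isCorner_faceAt x k))
    have hyB : x + cornerUnit k ∈ (E δ).zdBoundary := hk'.isFaceBoundaryEdge.mem_zdBoundary.1
    refine ⟨x + cornerUnit k, ⟨_, isCorner_faceAt _ j, hyin⟩, hyB, hadj, ?_, sepDict_dist_add_cornerUnit hδ x k⟩
    exact sepDict_not_AB_of_no_innerFace hadm hadj hno (hadm.zdBoundary_subset hx)
      (hadm.zdBoundary_subset hyB)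
  -- (3) the metric statement for `v'` wired to `a` and a `B`-site `w'` on an inner face
  have main : ∀ v' w' : Site 2,
      (E δ).bcBondConfig ω ∈ openConnIn Set.univ (startCorner hadm).1 v' → w' ∈ (E δ).zdArcB →
      (∃ F, IsCorner w' F ∧ (E δ).IsInnerFace F) →
      ∃ n ≤ exitTime hadm ω,
        dist (medialPoint (E δ).δ (cSrc (cornerOrbit ((E δ).bcBondConfig ω) (startCorner hadm) n)))
          (meshPoint (E δ).δ v') ≤ dist (meshPoint (E δ).δ v') (meshPoint (E δ).δ w') := by
    intro v' w' hv' hw' hF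
    obtain ⟨F, hwF, hF⟩ := hF
    obtain ⟨s, hsP, rfl⟩ := oncycle w' F ((E δ).zdArcB_subset_zdBoundary hw') hwF hF
    obtain ⟨hs1, hstb⟩ := sepDict_idx_of_mem_zdArcB hadm htbP htbeq hsP hw'
    -- `v'` is a site of `Ω_δ`
    have hv'm : v' ∈ meshVertices {w : ℂ | w.re < 0 ∧ w.im < 0 ∧ -1 < w.re + w.im} (E δ).δ := by
      obtain ⟨π, -, hπ⟩ := exists_walk_of_mem_openConnIn (G := zdGraph 2)
        (fun e he => edgeSet_subset_edgeSet.2 hGzd ((E δ).bcBondConfig_subset ω he)) hv'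
      rcases Walk.mem_support_iff_exists_mem_edges.1 π.reverse.start_mem_support with h | ⟨e, he, hve⟩
      · rw [h]; exact hmesh _ (isOutEdge_startCorner hadm).fst_mem_meshDomain
      · rw [Walk.edges_reverse, List.mem_reverse] at he
        have heG := (E δ).bcBondConfig_subset ω (hπ e he)
        have h' : s(v', Sym2.Mem.other hve) ∈ (discreteDomainGraph (E δ).Ω (E δ).δ).edgeSet := by
          rwa [Sym2.other_spec hve]
        exact hmesh _ (discreteDomainGraph_adj_iff.1 ((SimpleGraph.mem_edgeSet _).1 h')).2.1
    have hwm := hmesh _ (bwalk_fst_mem_meshDomain (isOutEdge_startCorner hadm) s)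
    obtain ⟨σ, hσ⟩ := sepDict_exists_boxWalk hδ hv'm hwm
    have hσG : ∀ e ∈ σ.edges, e ∈ (discreteDomainGraph (E δ).Ω (E δ).δ).edgeSet := by
      intro e he
      obtain ⟨d, hd, rfl⟩ := List.mem_map.1 he
      rw [Dart.edge, SimpleGraph.mem_edgeSet, hΩ, sepDict_tri_adj_iff hδ]
      exact ⟨d.adj, (hσ _ (σ.dart_fst_mem_support_of_mem_darts hd)).1,
        (hσ _ (σ.dart_snd_mem_support_of_mem_darts hd)).1⟩
    have hstb' : ∀ s' < s, (E δ).bwalk (startCorner hadm) s' ≠ ebDart hadm := by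
      intro s' hs' h
      rw [← htbeq] at h
      have := bwalk_injOn hadm (isOutEdge_startCorner hadm) (by omega) htbP h
      omega
    obtain ⟨e, he, n, hn, hen⟩ := touchExponent_sepDictionary_core D.toJordanDomain (E δ) hΩJ hadm ω
      v' s σ hs1 hstb' hv' hσG
    refine ⟨n, hn, ?_⟩
    obtain ⟨d, hd, hde⟩ := List.mem_map.1 he
    rw [← hen, ← hde]
    change dist (medialPoint (E δ).δ s(d.toProd.1, d.toProd.2)) _ ≤ _
    obtain ⟨-, b0, b1⟩ := hσ _ (σ.dart_fst_mem_support_of_mem_darts hd)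
    obtain ⟨-, b0', b1'⟩ := hσ _ (σ.dart_snd_mem_support_of_mem_darts hd)
    exact sepDict_dist_medialPoint_le _ _ _ _ (sepDict_dist_le_of_box _ b0 b1)
      (sepDict_dist_le_of_box _ b0' b1')
  -- (4) `v` is wired to the `A`-end of `e_a`
  have hwired : ∀ x : Site 2, x ∈ (E δ).zdArcA → (∃ F, IsCorner x F ∧ (E δ).IsInnerFace F) →
      (E δ).bcBondConfig ω ∈ openConnIn Set.univ (startCorner hadm).1 x := by
    rintro x hxA ⟨F, hxF, hF⟩
    obtain ⟨s, hsP, rfl⟩ := oncycle x F ((E δ).zdArcA_subset_zdBoundary hxA) hxF hF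
    exact sepDict_openConnIn_of_mem_zdArcA hadm ω htbP htbeq hsP hxA
  have hav : (E δ).bcBondConfig ω ∈ openConnIn Set.univ (startCorner hadm).1 v := by
    refine PlanarDuality.openConnIn_trans ?_ hconn
    by_cases hcase : ∃ F, IsCorner u F ∧ (E δ).IsInnerFace F
    · exact hwired u hu hcase
    · push Not at hcase
      obtain ⟨y, hyF, -, hadj, hlab, -⟩ := tip u ((E δ).zdArcA_subset_zdBoundary hu) hcase
      have hyA : y ∈ (E δ).zdArcA := by
        rcases hlab with ⟨-, h⟩ | ⟨h, -⟩
        · exact h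
        · exact absurd h (Set.disjoint_left.1 hadm.disjoint hu)
      refine PlanarDuality.openConnIn_trans (hwired y hyA hyF) ?_
      rw [openConnIn_comm]
      refine openConnIn_of_adj (Set.mem_univ _) (Set.mem_univ _) ?_ hadj.ne
      refine mem_bcBondConfig_of_arcA hadj fun z hz => ?_
      rcases Sym2.mem_iff.1 hz with rfl | rfl
      · exact hu
      · exact hyA
  -- (5) the metric statement for `w`, through a `B`-site on an inner face
  obtain ⟨n, hn, hdist⟩ : ∃ n ≤ exitTime hadm ω,
      dist (medialPoint (E δ).δ (cSrc (cornerOrbit ((E δ).bcBondConfig ω) (startCorner hadm) n)))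
        (meshPoint (E δ).δ v) ≤ dist (meshPoint (E δ).δ v) (meshPoint (E δ).δ w) + (E δ).δ := by
    by_cases hcase : ∃ F, IsCorner w F ∧ (E δ).IsInnerFace F
    · obtain ⟨n, hn, h⟩ := main v w hav hw hcase
      exact ⟨n, hn, h.trans (le_add_of_nonneg_right hδ.le)⟩
    · push Not at hcase
      obtain ⟨y, hyF, -, -, hlab, hdy⟩ := tip w ((E δ).zdArcB_subset_zdBoundary hw) hcase
      have hyB : y ∈ (E δ).zdArcB := by
        rcases hlab with ⟨h, -⟩ | ⟨-, h⟩
        · exact absurd h (Set.disjoint_right.1 hadm.disjoint hw)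
        · exact h
      obtain ⟨n, hn, h⟩ := main v y hav hyB hyF
      refine ⟨n, hn, h.trans ?_⟩
      have := dist_triangle (meshPoint (E δ).δ v) (meshPoint (E δ).δ w) (meshPoint (E δ).δ y)
      linarith
  -- (6) the midpoint of the visited edge is a vertex of the exploration polyline
  have hmem : medialPoint (E δ).δ (cSrc (cornerOrbit ((E δ).bcBondConfig ω) (startCorner hadm) n)) ∈
      Set.range (medialExplorationCurve (E δ) ω) := by
    rw [medialExplorationCurve, medialExploration_map_eq hadm]
    exact mem_range_polyline (List.mem_map.2 ⟨n, List.mem_range.2 (Nat.lt_succ_of_le hn), rfl⟩)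
  obtain ⟨t, ht⟩ := hmem
  refine ⟨t, ?_⟩
  rw [ht]
  linarith

end Summit.CriticalPhenomena.CardyFormulaZ2.Theorems.SymmetryUpgradeR.SwallowingSkeleton

end
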